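import Summits.QuantumFields.BalabanUV.Beta.LatticeFaberKrahn
import Summits.QuantumFields.BalabanUV.Beta.SubsolutionCaccioppoli
import Summits.QuantumFields.BalabanUV.Beta.TorusBoxSupersolution

/-!
# Beta / DeGiorgiStep — ONE STEP OF DE GIORGI'S ITERATION FOR A NONNEGATIVE SUB-SOLUTION OF THE FREE LATTICE LAPLACIAN ON A TORUS
# BOX: raising the level by `δ` and shrinking the ball by `s` contracts the truncated mass super-linearly,
# `U′ ≤ 416·d²·X²·U/s²` whenever `X^d ≥ 4U/δ²` (MODEL; unit torus `UT N`, constant bond weight; third module of «LATTICE-DEGIORGI-MV»)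

SETTING: the unit torus `UT N` with bonds `bsrc∕btgt` and a CONSTANT bond weight `c ≡ c₀ ≠ 0` (so `W ≡ 2d·c₀²`), a centre `x₀`, an outer
radius `R` with `10R + 4 ≤ N_i` (room for the Faber–Krahn tiles), and `z ≥ 0` with `W·z ≤ Nz` on the ball `dist(·, x₀) ≤ R` (the
torus `dist` is the sup of the circular coordinate distances; its balls are coordinate boxes).
THE STEP (**`step`**): for radii `s ≤ ρ ≤ R` (`s ≥ 1`), a level `l` and an increment `δ > 0`, with `v = (z − l)₊`, `v′ = (z − l − δ)₊`,
`U = Σ_{dist ≤ ρ} v²`, `U′ = Σ_{dist ≤ ρ − s} v′²` and ANY `X ≥ 0` with `4U/δ² ≤ X^d`:  **`U′ ≤ 416·d²·X²·U/s²`**.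
PROOF (all by name): `v′` is a nonnegative sub-solution (`SubsolutionCaccioppoli.posPart_sub_subsolution`); the cutoff
`η = clamp((ρ − dist(·,x₀))/s)` is `1` on the inner ball, `0` off the outer one and `1/s`-Lipschitz along bonds (§2); `w = ηv′` is supported
on `A = {η ≠ 0, z > l + δ} ⊆ {dist < ρ, v > δ}`, so CHEBYSHEV gives `#A ≤ U/δ² ≤ X^d/4`; the lattice FABER–KRAHN inequality
(`LatticeFaberKrahn.faberKrahn_ball`, tile side `r = min(⌈X⌉, 8R + 4) ≤ 2X`) gives `Σ w² ≤ 4d·r²·Σ_b (Δw)²`, and CACCIOPPOLI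
(`SubsolutionCaccioppoli.caccioppoli_cutoff`, `W ≡ 2dc₀²`, `v′ ≤ v`) gives `Σ_b (Δw)² ≤ 26d·U/s²`; `U′ = Σ_{inner} w² ≤ Σ w²`.
(unit `b2b-balaban-beta-d4-p2`, GEN 10, MODEL crew; claim «LATTICE-DEGIORGI-MV» journal l.22396; consumer: `DeGiorgiIteration`.)

HONEST FRAMING: discharging `BetaPertH` makes Bałaban's UV stability UNCONDITIONAL — NOT the continuum limit, NOT the
Clay problem.  HONEST DEPENDENCY (verbatim): «continuum YM on T⁴ ⇐ BetaPertH ∧ nine spine estimates (0/9 proved);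
BetaPertH ⇐ (D1) ∧ (D4) ∧ CAP+tail; G-an2-4 gates asym, D1 and NE2/3/4.»  THIS MODULE DISCHARGES NOTHING of `BetaPertH`,
asserts NOTHING printed and cites nothing as a fact (ABSOLUTE RULE): [folklore] finite lattice calculus (De Giorgi 1957 ∕ the Faber–Krahn
form of the iteration — method pointers only).  No class change on row D4 (critical-path width 0; D4 DISCHARGE NO DATE); NOT BetaPertH,
NOT continuum, NOT Clay, NOT summit progress.
-/

open scoped BigOperators
open Finset

namespace Summit.QuantumFields.BalabanUV.Beta.DeGiorgiStep

open Literature.MathematicalPhysics.QuantumFieldTheory.Balaban1983to89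
open Literature.MathematicalPhysics.QuantumFieldTheory.Balaban1983to89.B9Thm37GluePU (bsrc btgt bsrc_apply btgt_apply)
open B5TorusCover (UT)
open B5Leibniz121 (up dist_up_le)
open Summit.QuantumFields.BalabanUV.Beta.LatticeFaberKrahn (shift corner exists_shift_of_dist_le faberKrahn_ball)
open Summit.QuantumFields.BalabanUV.Beta.SubsolutionCaccioppoli (posPart_sub_subsolution caccioppoli_cutoff card_filter_mul_sq_le)
open Summit.QuantumFields.BalabanUV.Beta.TorusBoxSupersolution (sum_src_const sum_tgt_const)

noncomputable section

variable {d : ℕ} {N : Fin d → ℕ} [∀ i, NeZero (N i)]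

/-! ## §1 Torus facts: integrality of the distance, the size of a ball, the constant site weight -/

/-- The torus distance is a natural number. [folklore] -/
theorem dist_natCast (x y : UT N) : ∃ n : ℕ, dist x y = n := ⟨_, rfl⟩

/-- Integrality: `dist x y < n + 1 ⟹ dist x y ≤ n`. [folklore] -/
theorem dist_le_of_lt_add_one {x y : UT N} {n : ℕ} (h : dist x y < (n : ℝ) + 1) : dist x y ≤ n := by
  obtain ⟨m, hm⟩ := dist_natCast x y
  rw [hm] at h ⊢
  have h' : m < n + 1 := by exact_mod_cast h
  exact_mod_cast Nat.lt_add_one_iff.mp h'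

/-- **A ball of radius `R < N_i` has at most `(2R + 1)^d` sites** (it is a window of side `2R + 1`). [folklore] -/
theorem card_ball_le (x₀ : UT N) {R : ℕ} (hR : ∀ i, R < N i) :
    (univ.filter fun x : UT N => dist x x₀ ≤ R).card ≤ (2 * R + 1) ^ d := by
  classical
  have hsub : (univ.filter fun x : UT N => dist x x₀ ≤ R) ⊆
      (univ : Finset (Fin d → Fin (2 * R + 1))).image (fun w => shift (corner x₀ R) fun i => (w i : ℕ)) := by
    intro x hx
    obtain ⟨w, hw, hwx⟩ := exists_shift_of_dist_le x₀ hR (Finset.mem_filter.mp hx).2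
    exact Finset.mem_image.mpr ⟨fun i => ⟨w i, by have := hw i; omega⟩, Finset.mem_univ _, hwx⟩
  calc (univ.filter fun x : UT N => dist x x₀ ≤ R).card
      ≤ ((univ : Finset (Fin d → Fin (2 * R + 1))).image (fun w => shift (corner x₀ R) fun i => (w i : ℕ))).card :=
        Finset.card_le_card hsub
    _ ≤ (univ : Finset (Fin d → Fin (2 * R + 1))).card := Finset.card_image_le
    _ = (2 * R + 1) ^ d := by rw [Finset.card_univ, Fintype.card_pi, Finset.prod_const, Fintype.card_fin, Finset.card_univ, Fintype.card_fin]

/-- For a constant bond weight the site weight is `W ≡ 2d·c₀²`. [folklore] -/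
theorem W_const {c : UT N × Fin d → ℝ} {c₀ : ℝ} (hc : ∀ b, c b = c₀) (x : UT N) :
    ((∑ b ∈ univ.filter (fun b : UT N × Fin d => btgt b = x), c b ^ 2) +
        ∑ b ∈ univ.filter (fun b : UT N × Fin d => bsrc b = x), c b ^ 2) = 2 * d * c₀ ^ 2 := by
  rw [sum_tgt_const hc, sum_src_const hc]; ring

/-! ## §2 The cutoff `η = clamp((ρ − dist(·, x₀))/s)` -/

/-- The piecewise-linear cutoff between the balls of radii `ρ − s` and `ρ`. [folklore] -/
def cut (x₀ : UT N) (ρ s : ℕ) (x : UT N) : ℝ := max 0 (min 1 (((ρ : ℝ) - dist x x₀) / s))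

/-- `0 ≤ η`. [folklore] -/
theorem cut_nonneg (x₀ : UT N) (ρ s : ℕ) (x : UT N) : 0 ≤ cut x₀ ρ s x := le_max_left _ _

/-- `η ≤ 1`. [folklore] -/
theorem cut_le_one (x₀ : UT N) (ρ s : ℕ) (x : UT N) : cut x₀ ρ s x ≤ 1 :=
  max_le zero_le_one (min_le_left _ _)

/-- `η = 1` on the inner ball `dist ≤ ρ − s`. [folklore] -/
theorem cut_eq_one (x₀ : UT N) {ρ s : ℕ} (hs : 0 < s) {x : UT N} (hx : dist x x₀ + s ≤ ρ) : cut x₀ ρ s x = 1 := by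
  unfold cut
  have hs' : (0 : ℝ) < s := by exact_mod_cast hs
  have h1 : 1 ≤ ((ρ : ℝ) - dist x x₀) / s := by rw [le_div_iff₀ hs']; linarith
  rw [min_eq_left h1, max_eq_right zero_le_one]

/-- `η = 0` off the outer ball: `ρ ≤ dist(x, x₀) ⟹ η(x) = 0`. [folklore] -/
theorem cut_eq_zero (x₀ : UT N) {ρ s : ℕ} {x : UT N} (hx : (ρ : ℝ) ≤ dist x x₀) : cut x₀ ρ s x = 0 := by
  unfold cut
  have h1 : ((ρ : ℝ) - dist x x₀) / s ≤ 0 := div_nonpos_of_nonpos_of_nonneg (by linarith) (Nat.cast_nonneg _)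
  rw [max_eq_left ((min_le_right _ _).trans h1)]

/-- `η(x) ≠ 0 ⟹ dist(x, x₀) < ρ`. [folklore] -/
theorem dist_lt_of_cut_ne_zero (x₀ : UT N) {ρ s : ℕ} {x : UT N} (hx : cut x₀ ρ s x ≠ 0) : dist x x₀ < ρ := by
  by_contra h
  exact hx (cut_eq_zero x₀ (not_lt.mp h))

/-- **`η` is `1/s`-Lipschitz for the torus distance.** [folklore] -/
theorem abs_cut_sub_le (x₀ : UT N) (ρ : ℕ) {s : ℕ} (hs : 0 < s) (x y : UT N) :
    |cut x₀ ρ s x - cut x₀ ρ s y| ≤ dist x y / s := by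
  unfold cut
  have hs' : (0 : ℝ) < s := by exact_mod_cast hs
  -- the clamp `t ↦ max 0 (min 1 t)` is `1`-Lipschitz (cf. `Literature.NumberTheory.LFunctions.PlateauMollifier.abs_clamp_sub_clamp_le`)
  have hclamp : ∀ a b : ℝ, |max 0 (min 1 a) - max 0 (min 1 b)| ≤ |a - b| := by
    intro a b
    have h1 := abs_max_sub_max_le_max (0 : ℝ) (min 1 a) 0 (min 1 b)
    have h2 := abs_min_sub_min_le_max (1 : ℝ) a 1 b
    rw [sub_self, abs_zero] at h1 h2
    have h3 : max 0 |min 1 a - min 1 b| = |min 1 a - min 1 b| := max_eq_right (abs_nonneg _)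
    have h4 : max 0 |a - b| = |a - b| := max_eq_right (abs_nonneg _)
    rw [h3] at h1; rw [h4] at h2
    exact h1.trans h2
  refine (hclamp _ _).trans ?_
  rw [← sub_div, abs_div, abs_of_pos hs', div_le_div_iff_of_pos_right hs']
  calc |(ρ : ℝ) - dist x x₀ - ((ρ : ℝ) - dist y x₀)| = |dist y x₀ - dist x x₀| := by
        rw [show (ρ : ℝ) - dist x x₀ - ((ρ : ℝ) - dist y x₀) = -(dist x x₀ - dist y x₀) by ring, abs_neg, abs_sub_comm]
    _ ≤ dist y x := abs_dist_sub_le y x x₀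
    _ = dist x y := dist_comm y x

/-- Along a bond `η` changes by at most `1/s`. [folklore] -/
theorem abs_cut_bond_le (x₀ : UT N) (ρ : ℕ) {s : ℕ} (hs : 0 < s) (b : UT N × Fin d) :
    |cut x₀ ρ s (btgt b) - cut x₀ ρ s (bsrc b)| ≤ 1 / s := by
  have hs' : (0 : ℝ) < s := by exact_mod_cast hs
  refine (abs_cut_sub_le x₀ ρ hs _ _).trans (div_le_div_of_nonneg_right ?_ hs'.le)
  rw [btgt_apply, bsrc_apply, dist_comm]
  exact dist_up_le b.1 b.2

/-- **A bond across which `η` changes has both ends in the outer ball** `dist ≤ ρ` (one end has `dist < ρ`, the other is one step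
away, and distances are integers). [folklore] -/
theorem cut_jump_mem (x₀ : UT N) (ρ s : ℕ) (b : UT N × Fin d) (h : cut x₀ ρ s (btgt b) ≠ cut x₀ ρ s (bsrc b)) :
    btgt b ∈ univ.filter (fun x : UT N => dist x x₀ ≤ ρ) ∧ bsrc b ∈ univ.filter (fun x : UT N => dist x x₀ ≤ ρ) := by
  have hstep : dist (btgt b) (bsrc b) ≤ 1 := by rw [btgt_apply, bsrc_apply, dist_comm]; exact dist_up_le b.1 b.2
  simp only [Finset.mem_filter, Finset.mem_univ, true_and]
  by_cases ht : dist (btgt b) x₀ < ρ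
  · refine ⟨ht.le, dist_le_of_lt_add_one ?_⟩
    calc dist (bsrc b) x₀ ≤ dist (bsrc b) (btgt b) + dist (btgt b) x₀ := dist_triangle _ _ _
      _ < 1 + ρ := by rw [dist_comm (bsrc b)]; linarith
      _ = ρ + 1 := add_comm _ _
  · by_cases hsr : dist (bsrc b) x₀ < ρ
    · refine ⟨dist_le_of_lt_add_one ?_, hsr.le⟩
      calc dist (btgt b) x₀ ≤ dist (btgt b) (bsrc b) + dist (bsrc b) x₀ := dist_triangle _ _ _
        _ < 1 + ρ := by linarith
        _ = ρ + 1 := add_comm _ _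
    · exact absurd (by rw [cut_eq_zero x₀ (not_lt.mp ht), cut_eq_zero x₀ (not_lt.mp hsr)]) h

/-! ## §3 The step -/

/-- **ONE STEP OF DE GIORGI'S ITERATION (free lattice Laplacian, torus box, constant weight).**  See the module docstring:
with `v = (z − l)₊`, `v′ = (z − l − δ)₊`, `U = Σ_{dist ≤ ρ} v²`, for every `X ≥ 0` with `4U/δ² ≤ X^d`:
`Σ_{dist ≤ ρ − s} v′² ≤ 416·d²·X²/s²·U`. [folklore] -/
theorem step [NeZero d] {c : UT N × Fin d → ℝ} {c₀ : ℝ} (hc : ∀ b, c b = c₀) (hc₀ : c₀ ≠ 0) (x₀ : UT N) {R : ℕ}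
    (hN : ∀ i, 10 * R + 4 ≤ N i) (z : UT N → ℝ)
    (hz : ∀ x ∈ univ.filter (fun x : UT N => dist x x₀ ≤ R),
      ((∑ b ∈ univ.filter (fun b : UT N × Fin d => btgt b = x), c b ^ 2) +
          ∑ b ∈ univ.filter (fun b : UT N × Fin d => bsrc b = x), c b ^ 2) * z x ≤
        ((∑ b ∈ univ.filter (fun b : UT N × Fin d => btgt b = x), c b ^ 2 * z (bsrc b)) +
          ∑ b ∈ univ.filter (fun b : UT N × Fin d => bsrc b = x), c b ^ 2 * z (btgt b)))
    {ρ s : ℕ} (hs : 1 ≤ s) (hsρ : s ≤ ρ) (hρR : ρ ≤ R) (l : ℝ) {δ : ℝ} (hδ : 0 < δ) {X : ℝ} (hX0 : 0 ≤ X)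
    (hX : 4 * (∑ x ∈ univ.filter (fun x : UT N => dist x x₀ ≤ ρ), max (z x - l) 0 ^ 2) / δ ^ 2 ≤ X ^ d) :
    ∑ x ∈ univ.filter (fun x : UT N => dist x x₀ ≤ ((ρ - s : ℕ) : ℝ)), max (z x - (l + δ)) 0 ^ 2 ≤
      416 * (d : ℝ) ^ 2 * X ^ 2 / (s : ℝ) ^ 2 * ∑ x ∈ univ.filter (fun x : UT N => dist x x₀ ≤ ρ), max (z x - l) 0 ^ 2 := by
  classical
  -- names
  set v : UT N → ℝ := fun y => max (z y - l) 0 with hv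
  set v' : UT N → ℝ := fun y => max (z y - (l + δ)) 0 with hv'
  set η : UT N → ℝ := cut x₀ ρ s with hη
  set w : UT N → ℝ := fun y => η y * v' y with hw
  set U : ℝ := ∑ x ∈ univ.filter (fun x : UT N => dist x x₀ ≤ ρ), v x ^ 2 with hU
  have hd1 : 1 ≤ d := Nat.one_le_iff_ne_zero.mpr (NeZero.ne d)
  have hs0 : 0 < s := hs
  have hsR : (0 : ℝ) < s := by exact_mod_cast hs0
  have hv'0 : ∀ y, 0 ≤ v' y := fun y => le_max_right _ _
  have hv'le : ∀ y, v' y ≤ v y := fun y => max_le_max (by linarith) le_rfl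
  have hU0 : 0 ≤ U := Finset.sum_nonneg fun x _ => sq_nonneg _
  have hRN : ∀ i, R < N i := fun i => by have := hN i; omega
  -- `v'` is a nonnegative sub-solution on the ball of radius `R`
  have hsub' := posPart_sub_subsolution bsrc btgt c (univ.filter (fun x : UT N => dist x x₀ ≤ R)) z (l + δ) hz
  -- the support of `w`
  have hwsupp : ∀ x, w x ≠ 0 → dist x x₀ < ρ ∧ δ < v x := by
    intro x hx
    have hηx : η x ≠ 0 := fun h0 => hx (by rw [hw]; simp only; rw [h0, zero_mul])
    have hv'x : v' x ≠ 0 := fun h0 => hx (by rw [hw]; simp only; rw [h0, mul_zero])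
    refine ⟨dist_lt_of_cut_ne_zero x₀ hηx, ?_⟩
    have hzx : l + δ < z x := by
      by_contra hle
      exact hv'x (by rw [hv']; exact max_eq_right (by linarith))
    rw [hv]; simp only
    rw [max_eq_left (by linarith)]; linarith
  -- Chebyshev: `#supp w · δ² ≤ U`
  set A := univ.filter (fun x : UT N => w x ≠ 0) with hA
  have hAsub : A ⊆ (univ.filter (fun x : UT N => dist x x₀ ≤ ρ)).filter (fun x => δ < v x) := by
    intro x hx
    rw [Finset.mem_filter] at hx
    obtain ⟨h1, h2⟩ := hwsupp x hx.2
    exact Finset.mem_filter.mpr ⟨Finset.mem_filter.mpr ⟨Finset.mem_univ _, h1.le⟩, h2⟩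
  have hAU : (A.card : ℝ) * δ ^ 2 ≤ U := by
    have h1 : (A.card : ℝ) ≤ ((univ.filter (fun x : UT N => dist x x₀ ≤ ρ)).filter (fun x => δ < v x)).card := by
      exact_mod_cast Finset.card_le_card hAsub
    have h2 := card_filter_mul_sq_le (univ.filter (fun x : UT N => dist x x₀ ≤ ρ)) v hδ
    nlinarith [sq_nonneg δ]
  -- the inner sum is the sum of `w²` over the inner ball
  have hinner : ∑ x ∈ univ.filter (fun x : UT N => dist x x₀ ≤ ((ρ - s : ℕ) : ℝ)), v' x ^ 2 =
      ∑ x ∈ univ.filter (fun x : UT N => dist x x₀ ≤ ((ρ - s : ℕ) : ℝ)), w x ^ 2 := by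
    refine Finset.sum_congr rfl fun x hx => ?_
    have hxd := (Finset.mem_filter.mp hx).2
    have h1 : η x = 1 := by
      rw [hη]
      apply cut_eq_one x₀ hs0
      have : ((ρ - s : ℕ) : ℝ) = (ρ : ℝ) - s := by push_cast [Nat.cast_sub hsρ]; ring
      rw [this] at hxd; linarith
    rw [hw]; simp only; rw [h1, one_mul]
  have hinner_le : ∑ x ∈ univ.filter (fun x : UT N => dist x x₀ ≤ ((ρ - s : ℕ) : ℝ)), w x ^ 2 ≤ ∑ x, w x ^ 2 :=
    Finset.sum_le_sum_of_subset_of_nonneg (Finset.subset_univ _) fun x _ _ => sq_nonneg _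
  have hRHS0 : 0 ≤ 416 * (d : ℝ) ^ 2 * X ^ 2 / (s : ℝ) ^ 2 * U := by positivity
  rw [hinner]
  -- trivial case: `w ≡ 0`
  by_cases hA0 : A.card = 0
  · have hw00 : ∀ x, w x = 0 := by
      intro x
      by_contra hne
      have : x ∈ A := Finset.mem_filter.mpr ⟨Finset.mem_univ _, hne⟩
      rw [Finset.card_eq_zero.mp hA0] at this
      exact absurd this (Finset.notMem_empty _)
    have : ∑ x ∈ univ.filter (fun x : UT N => dist x x₀ ≤ ((ρ - s : ℕ) : ℝ)), w x ^ 2 = 0 :=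
      Finset.sum_eq_zero fun x _ => by rw [hw00 x]; ring
    rw [this]; exact hRHS0
  -- main case: `#A ≥ 1`, hence `X ≥ 1`
  have hA1 : 1 ≤ A.card := Nat.one_le_iff_ne_zero.mpr hA0
  have h4A : 4 * (A.card : ℝ) ≤ X ^ d := by
    have hδ2 : 0 < δ ^ 2 := by positivity
    have h1 : 4 * (A.card : ℝ) ≤ 4 * U / δ ^ 2 := by rw [le_div_iff₀ hδ2]; nlinarith
    exact h1.trans hX
  have hX1 : 1 ≤ X := by
    by_contra hlt
    push Not at hlt
    have h1 : X ^ d ≤ 1 := pow_le_one₀ hX0 hlt.le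
    have h1' : (1 : ℝ) ≤ A.card := by exact_mod_cast hA1
    linarith
  -- the tile side
  set r : ℕ := min ⌈X⌉₊ (8 * R + 4) with hr
  have hr1 : 1 ≤ r := by
    rw [hr]
    refine le_min ?_ (by omega)
    exact Nat.one_le_iff_ne_zero.mpr (Nat.pos_iff_ne_zero.mp (Nat.ceil_pos.mpr (by linarith)))
  have hrX : (r : ℝ) ≤ 2 * X := by
    have h1 : (r : ℝ) ≤ ⌈X⌉₊ := by exact_mod_cast min_le_left _ _
    have h2 := Nat.ceil_lt_add_one hX0
    linarith
  have hfit : ∀ i, 2 * R + r ≤ N i := fun i => by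
    have h1 : r ≤ 8 * R + 4 := min_le_right _ _
    have := hN i; omega
  have hAr : 4 * A.card ≤ r ^ d := by
    rcases min_choice ⌈X⌉₊ (8 * R + 4) with hm | hm
    · rw [hr, hm]
      have h1 : X ^ d ≤ ((⌈X⌉₊ : ℕ) : ℝ) ^ d := pow_le_pow_left₀ hX0 (Nat.le_ceil X) d
      exact_mod_cast h4A.trans h1
    · rw [hr, hm]
      have h1 : A.card ≤ (2 * R + 1) ^ d := by
        refine le_trans (Finset.card_le_card ?_) (card_ball_le x₀ hRN)
        intro x hx
        rw [Finset.mem_filter] at hx ⊢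
        exact ⟨Finset.mem_univ _, ((hwsupp x hx.2).1.le.trans (by exact_mod_cast hρR))⟩
      calc 4 * A.card ≤ 4 * (2 * R + 1) ^ d := Nat.mul_le_mul_left 4 h1
        _ ≤ 4 ^ d * (2 * R + 1) ^ d := Nat.mul_le_mul_right _ (by
            calc 4 = 4 ^ 1 := (pow_one 4).symm
              _ ≤ 4 ^ d := Nat.pow_le_pow_right (by norm_num) hd1)
        _ = (8 * R + 4) ^ d := by rw [← Nat.mul_pow]; ring_nf
  -- Faber–Krahn for `w`
  have hFK := faberKrahn_ball x₀ R hr1 hfit w (fun x hx => (hwsupp x hx).1.le.trans (by exact_mod_cast hρR)) (by rwa [hA] at hAr)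
  -- Caccioppoli for `η v'`
  have hsubη : ∀ x, η x ≠ 0 →
      ((∑ b ∈ univ.filter (fun b : UT N × Fin d => btgt b = x), c b ^ 2) +
          ∑ b ∈ univ.filter (fun b : UT N × Fin d => bsrc b = x), c b ^ 2) * v' x ≤
        ((∑ b ∈ univ.filter (fun b : UT N × Fin d => btgt b = x), c b ^ 2 * v' (bsrc b)) +
          ∑ b ∈ univ.filter (fun b : UT N × Fin d => bsrc b = x), c b ^ 2 * v' (btgt b)) := by
    intro x hx
    have hxR : x ∈ univ.filter (fun x : UT N => dist x x₀ ≤ R) :=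
      Finset.mem_filter.mpr ⟨Finset.mem_univ _, (dist_lt_of_cut_ne_zero x₀ hx).le.trans (by exact_mod_cast hρR)⟩
    exact hsub' x hxR
  have hC := caccioppoli_cutoff bsrc btgt c η v' hv'0 hsubη hsR (fun b => abs_cut_bond_le x₀ ρ hs0 b)
    (univ.filter (fun x : UT N => dist x x₀ ≤ ρ)) (fun b hb => cut_jump_mem x₀ ρ s b hb)
  -- constant weights: `Σ_b (Δw)² ≤ 26d·U/s²`
  have hc2 : (0 : ℝ) < c₀ ^ 2 := by positivity
  have hE : ∑ b : UT N × Fin d, (w (btgt b) - w (bsrc b)) ^ 2 ≤ 26 * d / (s : ℝ) ^ 2 * U := by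
    have hL : ∑ b : UT N × Fin d, c b ^ 2 * (η (btgt b) * v' (btgt b) - η (bsrc b) * v' (bsrc b)) ^ 2 =
        c₀ ^ 2 * ∑ b : UT N × Fin d, (w (btgt b) - w (bsrc b)) ^ 2 := by
      rw [Finset.mul_sum]
      exact Finset.sum_congr rfl fun b _ => by rw [hc b]
    have hR' : ∑ x ∈ univ.filter (fun x : UT N => dist x x₀ ≤ ρ),
        ((∑ b ∈ univ.filter (fun b : UT N × Fin d => btgt b = x), c b ^ 2) +
            ∑ b ∈ univ.filter (fun b : UT N × Fin d => bsrc b = x), c b ^ 2) * v' x ^ 2 ≤ 2 * d * c₀ ^ 2 * U := by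
      rw [hU, Finset.mul_sum]
      refine Finset.sum_le_sum fun x _ => ?_
      rw [W_const hc]
      exact mul_le_mul_of_nonneg_left (pow_le_pow_left₀ (hv'0 x) (hv'le x) 2) (by positivity)
    rw [hL] at hC
    have h1 : c₀ ^ 2 * ∑ b : UT N × Fin d, (w (btgt b) - w (bsrc b)) ^ 2 ≤ 13 / (s : ℝ) ^ 2 * (2 * d * c₀ ^ 2 * U) :=
      hC.trans (mul_le_mul_of_nonneg_left hR' (by positivity))
    have h2 : c₀ ^ 2 * ∑ b : UT N × Fin d, (w (btgt b) - w (bsrc b)) ^ 2 ≤ c₀ ^ 2 * (26 * d / (s : ℝ) ^ 2 * U) := by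
      calc _ ≤ 13 / (s : ℝ) ^ 2 * (2 * d * c₀ ^ 2 * U) := h1
        _ = c₀ ^ 2 * (26 * d / (s : ℝ) ^ 2 * U) := by ring
    exact le_of_mul_le_mul_left h2 hc2
  -- assembly
  have hr2 : (r : ℝ) * ((r : ℝ) - 1) ≤ (2 * X) ^ 2 := by
    have h0 : (1 : ℝ) ≤ r := by exact_mod_cast hr1
    nlinarith
  have hdr : 0 ≤ 4 * ((d : ℝ) * r * ((r : ℝ) - 1)) := by
    have h0 : (1 : ℝ) ≤ r := by exact_mod_cast hr1
    have : 0 ≤ (r : ℝ) - 1 := by linarith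
    positivity
  calc ∑ x ∈ univ.filter (fun x : UT N => dist x x₀ ≤ ((ρ - s : ℕ) : ℝ)), w x ^ 2
      ≤ ∑ x, w x ^ 2 := hinner_le
    _ ≤ 4 * ((d : ℝ) * r * ((r : ℝ) - 1)) * ∑ b : UT N × Fin d, (w (btgt b) - w (bsrc b)) ^ 2 := hFK
    _ ≤ 4 * ((d : ℝ) * r * ((r : ℝ) - 1)) * (26 * d / (s : ℝ) ^ 2 * U) := mul_le_mul_of_nonneg_left hE hdr
    _ = 4 * (d : ℝ) * ((r : ℝ) * ((r : ℝ) - 1)) * (26 * d / (s : ℝ) ^ 2 * U) := by ring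
    _ ≤ 4 * (d : ℝ) * (2 * X) ^ 2 * (26 * d / (s : ℝ) ^ 2 * U) :=
        mul_le_mul_of_nonneg_right (mul_le_mul_of_nonneg_left hr2 (by positivity)) (by positivity)
    _ = 416 * (d : ℝ) ^ 2 * X ^ 2 / (s : ℝ) ^ 2 * U := by
        field_simp
        ring

end

end Summit.QuantumFields.BalabanUV.Beta.DeGiorgiStep
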